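import Summits.QuantumFields.YangMills.Theorems.LuscherReductionTwistedTraceScalingRecordWeightRho
import Summits.QuantumFields.YangMills.Theorems.LuscherReductionTwistedTraceScalingGaugeActionLinear
import HarnessLib

/-!
# A small gauge transformation moves every link by `O(G)`: slice points of inner orbits stay in the fat tube of radius `ρ = r + 8G`
# (lane A of S-BASE, crux `TwistedTraceScaling` stmt-QuantumFields-20203, C4 INNER; design note `pub/ym-fleet/ym-luscher-20007-p1/COARSE-DESIGN.md` §23.8 (N1)/(N2))

`…SliceMeets` produces the slice point `U* = U^{P∘ξ}` with `‖ξ‖∞ ≤ K_L‖w‖∞`; `…RecordWeightRho` lets the fat radius `ρ` be chosen.  THIS FILE quantifies the choice: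
* `frobNorm_chartSU2_sub_one_le`: `‖P(v) − 1‖_F ≤ 4‖v‖∞` for `‖v‖∞ ≤ 1/2`;
* ★ `gaugeTransform_chart_mem_nearOne`: `U ∈ nearOne r`, `‖ξ_x‖∞ ≤ G ≤ 1/2` ⇒ `U^{P∘ξ} ∈ nearOne (r + 8G)`;
* ★★ `gaugeTransform_chart_mem_fatTubeRho`: the same with the orbit condition (gauge invariant): `U ∈ fatTubeRho δ ρ β`, `ρ β + 8G ≤ ρ' β` ⇒ `U^{P∘ξ} ∈ fatTubeRho δ ρ' β`.
So with `G = K_L·(stiff radius)` the indicator factor of `recordWeightRho` equals `1` at and near the slice point: the Laplace evaluation (N2) sees only the Gaussian.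
HONEST FRAMING: elementary estimates for a stub of a child of the CONDITIONAL reduction route R2b1; no spectral claim; C4 OPEN; not a gap, not Clay.
-/

set_option autoImplicit false

noncomputable section

open Real
open scoped BigOperators
open Literature.MathematicalPhysics.QuantumFieldTheory
open Literature.MathematicalPhysics.QuantumLattice

namespace Summit.QuantumFields.YangMills.Theorems.FemtoTransferGap.TwoLattice.ConstTube

open Summit.QuantumFields.YangMills.Theorems.FemtoTransferGap

variable (L : ℕ) [NeZero L]

omit [NeZero L] in
/-- `‖P(v) − 1‖_F ≤ 4‖v‖∞` for `‖v‖∞ ≤ 1/2`. [folklore] -/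
theorem frobNorm_chartSU2_sub_one_le {v : Fin 3 → ℝ} (hv : ‖v‖ ≤ 1 / 2) : frobNorm (((chartSU2 v : SU2) : Matrix (Fin 2) (Fin 2) ℂ) - 1) ≤ 4 * ‖v‖ := by
  obtain ⟨_, h1, _⟩ := one_sub_sqrt_le hv
  have hs1 : ∑ a, v a ^ 2 ≤ 1 := by
    have h3 := sum_sq_le_three_norm_sq v
    nlinarith [norm_nonneg v]
  have hsq : frobNorm (((chartSU2 v : SU2) : Matrix (Fin 2) (Fin 2) ℂ) - 1) ^ 2 ≤ (4 * ‖v‖) ^ 2 := by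
    rw [frobNorm_sub_one_sq_eq_scalarPart, scalarPart_chartSU2 hs1]
    nlinarith [norm_nonneg v]
  exact (abs_le_of_sq_le_sq' hsq (by positivity)).2

omit [NeZero L] in
/-- ★ **A small gauge transformation moves links by `8G`**: `U ∈ nearOne r`, `‖ξ_x‖∞ ≤ G ≤ 1/2` ⇒ `U^{P∘ξ} ∈ nearOne (r + 8G)`. [folklore] -/
theorem gaugeTransform_chart_mem_nearOne {U : GaugeConfig 3 L SU2} {r G : ℝ} (hU : U ∈ nearOne L r) {ξ : Site 3 L → Fin 3 → ℝ} (hG : ∀ x, ‖ξ x‖ ≤ G)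
    (hG1 : G ≤ 1 / 2) : gaugeTransform (fun x => chartSU2 (ξ x)) U ∈ nearOne L (r + 8 * G) := by
  intro e
  have h := frobNorm_gaugeTransform_sub_one_le L (fun x => chartSU2 (ξ x)) U e
  have h1 := frobNorm_chartSU2_sub_one_le ((hG e.1).trans hG1)
  have h2 := frobNorm_chartSU2_sub_one_le ((hG (e.1.shift e.2)).trans hG1)
  have hUe := hU e
  linarith [hG e.1, hG (e.1.shift e.2)]

/-- ★★ **Slice points stay in the fat tube**: `U ∈ fatTubeRho δ ρ β`, `‖ξ_x‖∞ ≤ G ≤ 1/2`, `ρ β + 8G ≤ ρ' β` ⇒ `U^{P∘ξ} ∈ fatTubeRho δ ρ' β`. [folklore] -/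
theorem gaugeTransform_chart_mem_fatTubeRho {δ ρ ρ' : ℝ → ℝ} {β : ℝ} {U : GaugeConfig 3 L SU2} (hU : U ∈ fatTubeRho L δ ρ β)
    {ξ : Site 3 L → Fin 3 → ℝ} {G : ℝ} (hG : ∀ x, ‖ξ x‖ ≤ G) (hG1 : G ≤ 1 / 2) (hρ' : ρ β + 8 * G ≤ ρ' β) :
    gaugeTransform (fun x => chartSU2 (ξ x)) U ∈ fatTubeRho L δ ρ' β := by
  refine ⟨fun e => lt_of_lt_of_le (gaugeTransform_chart_mem_nearOne L hU.1 hG hG1 e) hρ', ?_⟩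
  show orbitDist (gaugeTransform (fun x => chartSU2 (ξ x)) U) < δ β
  rw [orbitDist_gaugeTransform]; exact hU.2

/-- In particular the indicator factor of `recordWeightRho δ ρ'` is `1` there. [folklore] -/
theorem recordWeightRho_gaugeTransform_chart_eq {δ ρ ρ' δg : ℝ → ℝ} {β : ℝ} {U : GaugeConfig 3 L SU2} (hU : U ∈ fatTubeRho L δ ρ β)
    {ξ : Site 3 L → Fin 3 → ℝ} {G : ℝ} (hG : ∀ x, ‖ξ x‖ ≤ G) (hG1 : G ≤ 1 / 2) (hρ' : ρ β + 8 * G ≤ ρ' β) :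
    recordWeightRho L δ ρ' δg β (gaugeTransform (fun x => chartSU2 (ξ x)) U) =
      Real.exp (-(gaugeCoordSq L (gaugeTransform (fun x => chartSU2 (ξ x)) U) / δg β ^ 2)) := by
  unfold recordWeightRho
  rw [Set.indicator_of_mem (gaugeTransform_chart_mem_fatTubeRho L hU hG hG1 hρ'), one_mul]

end Summit.QuantumFields.YangMills.Theorems.FemtoTransferGap.TwoLattice.ConstTube

end
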